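/-
Copyright: cell `pub-ymgap` (HUMAN RULING D-0062), Track A of `YM-PLAN.md`, DAG node N20 (= NE7b); R134 seat `pub-ymgap-dag-n20-d`
(strategy s3 «alternative currency», generation 5), module 7.  Released under the licence of the surrounding project.
-/
import Summits.QuantumFields.YangMills.Theorems.BalabanUVNodesN20LCSAvgExpMoment
import Summits.QuantumFields.YangMills.Theorems.BalabanUVNodesN20LCSAvgTransfer
import HarnessLib

/-!
# YM-DAG node N20 (= NE7b), strategy s3, THE FOURTH CURRENCY «BY VALUE» (module 7, an INSTANCE): THE (LS) LADDER TO EVERY LEVEL — the plaquette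
# energies of Bałaban's `k`-fold (0.4) block average `Ū^k = M^k(U)` of the level-0 lattice Yang–Mills field have LOCAL EXPONENTIAL MOMENTS under the
# level-0 Gibbs state at every level `k`, `∫ e^{δβ Σ_{p∈Q}(1 − reTr Ū^k(∂p))} dμ_β ≤ e^{C_k δ #Q}` (`0 ≤ δ ≤ δ_k`, `β ≥ 4N`, uniformly in the volume),
# hence PEIERLS AT EVERY LEVEL: a prescribed set of large plaquettes of `Ū^k` is exponentially rare in `β` per plaquette

Track A of `YM-PLAN.md` (cell `pub-ymgap`, HUMAN RULING D-0062), node **N20** = spine estimate NE7b (`T4WeightBudget.RelWeightBound` — the cell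
`pub-balaban`'s OWN estimate, NOT PRINTED in [Bałaban 1983–89], NOT PROVED).  Seat `pub-ymgap-dag-n20-d` (R134, s3), generation 5, module 7 (after the
fourth-currency package p496513 · p497227 · p498565 · p500598 · p501576 and the two-level instance p502557).  Kernel theorems only: 0 `def`, 0 `sorry`,
standard axioms; COUNT-NEUTRAL (`--supports` K3‴ `SpineGivenEndpointR13`, stmt-QuantumFields-19912, `--as helper`).  Restate-immune.

THE POINT.  In the fourth currency the per-class residual of NE7b is ONE joint-sparseness ∕ joint-moment inequality for the ITERATED block averages
`Averaging.iter (avOfRecord F N K) k U` under the level-0 state (modules 2 ∕ 3 ∕ 5).  Generation 3 typed (LS) RUNG 1 (`N20LCSAvgExpMoment.localExpMoment_avgFun`: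
the once-averaged field) and the TRANSFER RULE at any level under any finite state (`N20LCSAvgTransfer.localExpMoment_avgFun_of_moments`); n20-c typed rung 0 at
the record (`N20LCSAtRecordLevelZero.localExpMoment_gibbsMeasure`).  THIS FILE climbs the whole ladder: by induction on `k`, the transfer rule applied to the
IMAGE MEASURE `(gibbsMeasure P β).map Ū^k` (a finite measure on the level-`k` fields; `integral_map` + `T4Continuum.measurable_iter`) turns rung `k` into rung
`k + 1`, with `δ_{k+1} = δ_k ∕ (A·M)` and `C_{k+1} = C_k·A·M²` (`A`, `M` the transfer rule's letters, functions of `N`, `L` only).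
* §1 helpers: `measurable_iterBlockAvg` (the `k`-fold average of record is measurable), `measurable_exp_plaqSum_iter` ∕ `abs_exp_plaqSum_iter_le` ∕
  `integrable_exp_plaqSum_iter` (the level-`k` carrier composed with `Ū^k` is bounded-measurable, integrable under `μ_β`).
* §2 ★★ **`localExpMoment_iterAvgFun`** ((LS) RUNG `k` FOR EVERY `k`): for every `N ≥ 1`, `L`, `k` there are `δ_k > 0`, `C_k ≥ 0` such that for every `d = 4`
  parameter set `P` with `P.L = L` and `k ≤ m + K`, every `β ≥ 4N`, every `0 ≤ δ ≤ δ_k` and every finite `Q ⊆ Plaq P k`,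
    `∫ e^{δβ Σ_{p∈Q}(1 − reTr Ū^k(∂p))} d(gibbsMeasure P β) ≤ e^{C_k δ #Q}`,  `Ū^k = Averaging.iter (fun j => blockAvg expMeanLogSU) k U`.
* §3 ★ **`gibbsMeasure_largeField_iterAvgFun_le`** (PEIERLS AT LEVEL `k`): with those constants, for every threshold `ε` and finite `Y ⊆ Plaq P k`,
    `μ_β{U | ∀ p ∈ Y, ε ≤ 1 − reTr Ū^k(∂p)} ≤ e^{C_k δ_k #Y}·e^{−δ_k β ε #Y}`
  — the (JS) letter for a pin at ANY ONE level `k` is INHABITED (n20-c's `gibbsMeasure_largeField_le` = level 0, generation 3's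
  `gibbsMeasure_largeField_avgFun_le` = level 1).

HONEST FRAMING.  An INSTANCE with LETTER-BASED, LEVEL-DEPENDENT constants: `δ_k`, `C_k` degrade geometrically in `k` (`(A·M)^{−k}`, `(A·M²)^k` — the domination
letter is extensive in the averaging box), so NOTHING here is uniform along a renewal chain; the located wall of NE7b in the fourth currency is exactly the
LEVEL-UNIFORMITY of such constants (Bałaban's inductive small-field analysis), print's KIND, not print's statement.  Nothing of Bałaban's is asserted; NE7b NOT
PRINTED ∕ NOT PROVED; the (α)-instance 0∕1; N20 NOT discharged (typed 28∕28, discharged count untouched); one finite four-torus programme at fixed `ε` — NOT ℝ⁴,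
NOT infinite volume, NOT OS, NOT a mass gap, NOT Clay.  References (LOCATORS only; no decl carries a cite tag): T. Bałaban, CMP **98** (1985) 17–51
[Balaban1985Averaging] (Prop. 1 (51) p. 26); CMP **109** (1987) [Balaban1987RG1] ((0.4), (0.11) p. 253); CMP **122** (1989) 175–202 [Balaban1989LargeFieldI]
((0.1) p. 175).
-/

set_option autoImplicit false

noncomputable section

open scoped BigOperators Matrix.Norms.L2Operator
open MeasureTheory
open Literature.MathematicalPhysics.QuantumFieldTheory.Balaban1983to89
open T4Continuum T4ReflectionCone BlockAveraging ExpMeanLog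
open Summit.QuantumFields.YangMills.BalabanUVNodes.N20LCSAtRecordLevelZero (localExpMoment_gibbsMeasure)
open Summit.QuantumFields.YangMills.BalabanUVNodes.N20LCSAvgTransfer
  (localExpMoment_avgFun_of_moments measurable_exp_plaqSum_gen abs_exp_plaqSum_gen_le)
open Summit.QuantumFields.YangMills.BalabanUVNodes.N20LCSCoarseSparseness (measureReal_forall_le_le_of_expMoment)

namespace Summit.QuantumFields.YangMills.BalabanUVNodes.N20ByValueLadder

variable {N : ℕ} [NeZero N]

/-! ## §1 The `k`-fold average of record and the level-`k` carrier composed with it -/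

section Helpers

variable (P : Params)

/-- Bałaban's `k`-fold (0.4) block average `Ū^k = Averaging.iter (fun j => blockAvg expMeanLogSU) k` is measurable. [folklore] -/
theorem measurable_iterBlockAvg (k : ℕ) :
    Measurable (Averaging.iter (P := P) (G := Matrix.specialUnitaryGroup (Fin N) ℂ) (fun _ => blockAvg (expMeanLogSU (n := Fin N))) k) :=
  measurable_iter _ (fun _ => measurable_avgFun (expMeanLogSU (n := Fin N)) measurable_expMeanLogSU_E) k

/-- The level-`k` carrier composed with `Ū^k`, `U ↦ e^{t Σ_{p∈Q}(1 − reTr Ū^k(∂p))}`, is measurable. [folklore] -/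
theorem measurable_exp_plaqSum_iter (k : ℕ) (t : ℝ) (Q : Finset (Plaq P k)) :
    Measurable fun U : GaugeField P 0 (Matrix.specialUnitaryGroup (Fin N) ℂ) =>
      Real.exp (t * ∑ p ∈ Q, (1 - reTr (GaugeField.plaqHol
        (Averaging.iter (fun _ => blockAvg (expMeanLogSU (n := Fin N))) k U) p))) :=
  (measurable_exp_plaqSum_gen (n := Fin N) t Q).comp (measurable_iterBlockAvg P k)

/-- … and bounded by `e^{|t|·2·#Q}`. [folklore] -/
theorem abs_exp_plaqSum_iter_le (k : ℕ) (t : ℝ) (Q : Finset (Plaq P k)) (U : GaugeField P 0 (Matrix.specialUnitaryGroup (Fin N) ℂ)) :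
    |Real.exp (t * ∑ p ∈ Q, (1 - reTr (GaugeField.plaqHol
        (Averaging.iter (fun _ => blockAvg (expMeanLogSU (n := Fin N))) k U) p)))| ≤ Real.exp (|t| * (2 * Q.card)) :=
  abs_exp_plaqSum_gen_le (n := Fin N) t Q _

/-- … hence integrable under the level-0 Gibbs state (`β ≥ 0`). [folklore] -/
theorem integrable_exp_plaqSum_iter {β : ℝ} (hβ : 0 ≤ β) (k : ℕ) (t : ℝ) (Q : Finset (Plaq P k)) :
    Integrable (fun U : GaugeField P 0 (Matrix.specialUnitaryGroup (Fin N) ℂ) =>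
        Real.exp (t * ∑ p ∈ Q, (1 - reTr (GaugeField.plaqHol
          (Averaging.iter (fun _ => blockAvg (expMeanLogSU (n := Fin N))) k U) p))))
      (T4GenFunBounds.gibbsMeasure P β : Measure (GaugeField P 0 (Matrix.specialUnitaryGroup (Fin N) ℂ))) := by
  haveI := T4GenFunBounds.isProbabilityMeasure_gibbsMeasure (G := Matrix.specialUnitaryGroup (Fin N) ℂ) P hβ
  refine (integrable_const (Real.exp (|t| * (2 * Q.card)))).mono' (measurable_exp_plaqSum_iter P k t Q).aestronglyMeasurable
    (ae_of_all _ fun U => ?_)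
  rw [Real.norm_eq_abs]
  exact abs_exp_plaqSum_iter_le P k t Q U

end Helpers

/-! ## §2 (LS) rung `k` for every `k` -/

section Ladder

/-- **THE (LS) LADDER TO EVERY LEVEL.**  For every `N ≥ 1`, `L` and `k` there are `δ_k > 0` and `C_k ≥ 0` such that for every `d = 4` parameter set `P`
with `P.L = L` and `k ≤ m + K`, every `β ≥ 4N`, every `0 ≤ δ ≤ δ_k` and every finite set `Q` of level-`k` plaquettes,
  `∫ e^{δβ Σ_{p∈Q}(1 − reTr Ū^k(∂p))} d(gibbsMeasure P β) ≤ e^{C_k δ #Q}`,  `Ū^k = Averaging.iter (fun j => blockAvg expMeanLogSU) k U`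
— the plaquette energies of the `k`-fold averaged lattice Yang–Mills field have local exponential moments at scale `1∕β`, uniformly in `β ≥ 4N` and in the
volume (induction on `k`: rung 0 = `localExpMoment_gibbsMeasure`; the step is the transfer rule `localExpMoment_avgFun_of_moments` on the image measure
`μ_β.map Ū^k`, read back through `integral_map`; `δ_{k+1} = δ_k∕(A·M)`, `C_{k+1} = C_k·A·M²`). [folklore] -/
theorem localExpMoment_iterAvgFun (N : ℕ) [NeZero N] (L k : ℕ) :
    ∃ δ₀ : ℝ, 0 < δ₀ ∧ ∃ C : ℝ, 0 ≤ C ∧ ∀ (P : Params), P.d = 4 → P.L = L → k ≤ P.m + P.K →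
      ∀ (β : ℝ), 4 * N ≤ β → ∀ (δ : ℝ), 0 ≤ δ → δ ≤ δ₀ → ∀ (Q : Finset (Plaq P k)),
        ∫ U, Real.exp (δ * β * ∑ p ∈ Q, (1 - reTr (GaugeField.plaqHol
              (Averaging.iter (fun _ => blockAvg (expMeanLogSU (n := Fin N))) k U) p)))
            ∂(T4GenFunBounds.gibbsMeasure P β : Measure (GaugeField P 0 (Matrix.specialUnitaryGroup (Fin N) ℂ))) ≤
          Real.exp (C * δ * Q.card) := by
  induction k with
  | zero =>
      obtain ⟨C₀, hC₀, h0⟩ := localExpMoment_gibbsMeasure N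
      exact ⟨1 / 12, by norm_num, C₀, hC₀, fun P hd _ _ β hβ δ hδ hδle Q => h0 P hd β hβ δ hδ hδle Q⟩
  | succ k ih =>
      obtain ⟨δk, hδk, Ck, hCk, hk⟩ := ih
      -- the transfer rule's letters (functions of `N`, `L` only)
      set Nr : ℝ := (Fintype.card (Fin N) : ℝ) with hNr
      set κ : ℝ := ((((4 + 2) * L : ℕ) : ℝ) ^ 2 / 4) with hκ
      set CL : ℝ := (L : ℝ) ^ 2 + 6 * (((4 + 2) * L : ℕ) : ℝ) ^ 2 with hCL
      set α : ℝ := (deltaSU (Fin N) / (2 * (κ + 1))) ^ 2 / (2 * Nr) with hαdef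
      set A : ℝ := 2 * Nr * CL ^ 2 + 2 / α with hA
      set M : ℕ := (2 * ((4 + 3) * L + 2) + 1) ^ 4 * 4 ^ 2 with hM
      have hNr0 : 0 < Nr := by rw [hNr]; exact_mod_cast Fintype.card_pos
      have hκ0 : 0 ≤ κ := by positivity
      have hδN := deltaSU_pos (n := Fin N)
      have hα0 : 0 < α := by positivity
      have hA0 : 0 < A := by positivity
      have hMpos : 0 < M := by positivity
      have hM0 : (0 : ℝ) < (M : ℝ) := by exact_mod_cast hMpos
      have hsqrt : Real.sqrt (2 * Nr * α) = deltaSU (Fin N) / (2 * (κ + 1)) := by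
        rw [hαdef, mul_div_cancel₀ _ (by positivity : (2 : ℝ) * Nr ≠ 0)]
        exact Real.sqrt_sq (by positivity)
      have hguard : κ * Real.sqrt (2 * Nr * α) < deltaSU (Fin N) := by
        rw [hsqrt]
        have h1 : κ / (2 * (κ + 1)) < 1 := by
          rw [div_lt_one (by positivity)]; linarith
        calc κ * (deltaSU (Fin N) / (2 * (κ + 1))) = deltaSU (Fin N) * (κ / (2 * (κ + 1))) := by ring
          _ < deltaSU (Fin N) * 1 := mul_lt_mul_of_pos_left h1 hδN
          _ = deltaSU (Fin N) := mul_one _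
      refine ⟨δk / (A * M), by positivity, Ck * A * M * M, by positivity, ?_⟩
      intro P hd hL hmK β hβ δ hδ0 hδ1 Q
      have hNpos : (0 : ℝ) < N := Nat.cast_pos.mpr (Nat.pos_of_ne_zero (NeZero.ne N))
      have hβ0 : 0 ≤ β := le_trans (by positivity) hβ
      have hk_le : k ≤ P.m + P.K := Nat.le_of_succ_le hmK
      have hdL1 : ((P.d + 2) * P.L : ℕ) = (4 + 2) * L := by rw [hd, hL]
      have hdL2 : (2 * ((P.d + 3) * P.L + 2) + 1) ^ P.d * P.d ^ 2 = M := by rw [hd, hL]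
      have hPL : (P.L : ℝ) = (L : ℝ) := by rw [hL]
      have hguardP : ((((P.d + 2) * P.L : ℕ) : ℝ) ^ 2 / 4) * Real.sqrt (2 * (Fintype.card (Fin N) : ℝ) * α) < deltaSU (Fin N) := by
        rw [hdL1]; exact hguard
      -- the image measure of the level-0 Gibbs state under `Ū^k`
      haveI := T4GenFunBounds.isProbabilityMeasure_gibbsMeasure (G := Matrix.specialUnitaryGroup (Fin N) ℂ) P hβ0
      set μ : Measure (GaugeField P 0 (Matrix.specialUnitaryGroup (Fin N) ℂ)) := T4GenFunBounds.gibbsMeasure P β with hμ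
      set itk := Averaging.iter (P := P) (G := Matrix.specialUnitaryGroup (Fin N) ℂ) (fun _ => blockAvg (expMeanLogSU (n := Fin N))) k
        with hitk
      have hitk_meas : Measurable itk := measurable_iterBlockAvg P k
      set ν : Measure (GaugeField P k (Matrix.specialUnitaryGroup (Fin N) ℂ)) := μ.map itk with hν
      haveI : IsFiniteMeasure ν := Measure.isFiniteMeasure_map μ itk
      -- rung `k` read on the image measure
      have hLS : ∀ a : ℝ, 0 ≤ a → a ≤ δk → ∀ X : Finset (Plaq P k),
          ∫ V, Real.exp (a * β * ∑ q ∈ X, (1 - reTr (GaugeField.plaqHol V q))) ∂ν ≤ Real.exp (Ck * a * X.card) := by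
        intro a ha0 ha1 X
        rw [hν, integral_map hitk_meas.aemeasurable (measurable_exp_plaqSum_gen (n := Fin N) (a * β) X).aestronglyMeasurable]
        exact hk P hd hL hk_le β hβ a ha0 ha1 X
      -- the transfer rule at level `k` under `ν`
      have hδAM : δ * ((2 * (Fintype.card (Fin N) : ℝ) * ((P.L : ℝ) ^ 2 + 6 * (((P.d + 2) * P.L : ℕ) : ℝ) ^ 2) ^ 2 + 2 / α) *
          (((2 * ((P.d + 3) * P.L + 2) + 1) ^ P.d * P.d ^ 2 : ℕ) : ℝ)) ≤ δk := by
        rw [hdL1, hdL2, hPL]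
        calc δ * (A * M) ≤ δk / (A * M) * (A * M) := mul_le_mul_of_nonneg_right hδ1 (by positivity)
          _ = δk := by field_simp
      have htr := localExpMoment_avgFun_of_moments (n := Fin N) (P := P) (j := k) hmK hα0 hguardP ν hβ0 hCk hLS hδ0 hδAM Q
      rw [hdL1, hdL2, hPL] at htr
      -- read back on the level-0 state: `avgFun (Ū^k U) = Ū^{k+1} U`
      have hmeasQ : Measurable fun V : GaugeField P k (Matrix.specialUnitaryGroup (Fin N) ℂ) =>
          Real.exp (δ * β * ∑ p ∈ Q, (1 - reTr (GaugeField.plaqHol (avgFun (expMeanLogSU (n := Fin N)) V) p))) :=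
        (measurable_exp_plaqSum_gen (n := Fin N) (δ * β) Q).comp
          (measurable_avgFun (expMeanLogSU (n := Fin N)) measurable_expMeanLogSU_E)
      rw [hν, integral_map hitk_meas.aemeasurable hmeasQ.aestronglyMeasurable] at htr
      have e : (fun U : GaugeField P 0 (Matrix.specialUnitaryGroup (Fin N) ℂ) =>
          Real.exp (δ * β * ∑ p ∈ Q, (1 - reTr (GaugeField.plaqHol (avgFun (expMeanLogSU (n := Fin N)) (itk U)) p)))) =
          fun U => Real.exp (δ * β * ∑ p ∈ Q, (1 - reTr (GaugeField.plaqHol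
            (Averaging.iter (fun _ => blockAvg (expMeanLogSU (n := Fin N))) (k + 1) U) p))) := by
        funext U; rfl
      rw [e] at htr
      refine htr.trans (le_of_eq ?_)
      congr 1
      rw [hA, hCL, hNr]
      ring

end Ladder

/-! ## §3 Peierls at every level -/

section Peierls

/-- **LARGE-FIELD SPARSENESS AT EVERY LEVEL** (under the level-0 lattice Yang–Mills state): with the `δ_k > 0`, `C_k ≥ 0` of `localExpMoment_iterAvgFun`,
for every `d = 4` parameter set `P` (`P.L = L`, `k ≤ m + K`), every `β ≥ 4N`, every threshold `ε` and every finite set `Y` of level-`k` plaquettes,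
  `μ_β{U | ∀ p ∈ Y, ε ≤ 1 − reTr Ū^k(∂p)} ≤ e^{C_k δ_k #Y}·e^{−δ_k β ε #Y}`
— a prescribed set of large plaquettes of the `k`-fold averaged field is exponentially rare in `β`, per plaquette: the (JS) letter of the fourth currency for
a pin at any one level `k`, INHABITED with letter-based constants. [folklore] -/
theorem gibbsMeasure_largeField_iterAvgFun_le (N : ℕ) [NeZero N] (L k : ℕ) :
    ∃ δ₀ : ℝ, 0 < δ₀ ∧ ∃ C : ℝ, 0 ≤ C ∧ ∀ (P : Params), P.d = 4 → P.L = L → k ≤ P.m + P.K →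
      ∀ (β : ℝ), 4 * N ≤ β → ∀ (ε : ℝ) (Y : Finset (Plaq P k)),
        (T4GenFunBounds.gibbsMeasure P β : Measure (GaugeField P 0 (Matrix.specialUnitaryGroup (Fin N) ℂ))).real
            {U | ∀ p ∈ Y, ε ≤ 1 - reTr (GaugeField.plaqHol
              (Averaging.iter (fun _ => blockAvg (expMeanLogSU (n := Fin N))) k U) p)} ≤
          Real.exp (C * δ₀ * Y.card) * Real.exp (-(δ₀ * β * ε * Y.card)) := by
  obtain ⟨δ₀, hδ₀, C, hC, h⟩ := localExpMoment_iterAvgFun N L k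
  refine ⟨δ₀, hδ₀, C, hC, fun P hd hL hmK β hβ ε Y => ?_⟩
  have hNpos : (0 : ℝ) < N := Nat.cast_pos.mpr (Nat.pos_of_ne_zero (NeZero.ne N))
  have hβ0 : 0 ≤ β := le_trans (by positivity) hβ
  haveI := T4GenFunBounds.isProbabilityMeasure_gibbsMeasure (G := Matrix.specialUnitaryGroup (Fin N) ℂ) P hβ0
  have hmarkov := measureReal_forall_le_le_of_expMoment
    (T4GenFunBounds.gibbsMeasure P β : Measure (GaugeField P 0 (Matrix.specialUnitaryGroup (Fin N) ℂ))) Y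
    (fun p U => 1 - reTr (GaugeField.plaqHol (Averaging.iter (fun _ => blockAvg (expMeanLogSU (n := Fin N))) k U) p))
    (ε := ε) hδ₀.le hβ0 (integrable_exp_plaqSum_iter P hβ0 k (δ₀ * β) Y)
  exact hmarkov.trans (mul_le_mul_of_nonneg_right (h P hd hL hmK β hβ δ₀ hδ₀.le le_rfl Y) (Real.exp_pos _).le)

end Peierls

end Summit.QuantumFields.YangMills.BalabanUVNodes.N20ByValueLadder
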